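import Summits.BirchSwinnertonDyer.BirchSwinnertonDyer.Theorems.ThetaPartnerAtTwoSignedControlAtTwoShaThreeSylowField
import Literature.NumberTheory.GaloisRepresentations.KummerSES
import Literature.NumberTheory.GaloisCohomology.ArchimedeanInvariantMap
import Literature.NumberTheory.EllipticCurves.TwoDescentTwoTorsionCharacter
import HarnessLib

/-!
# The base case of Milne I Thm. 4.10 (c)₃ — `H³(F, ℤ/2) ↪ ⊕_{w real} H³(F_w, ℤ/2)` — from two statements about the
# Brauer group (K4 `SignedControlAtTwo` stub 3; the (hbase) input of `poitouTate_three_realPlaces_injective_of_base`)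

Route `ThetaPartnerAtTwo` (TP2; crux shared with `ResidualThetaTransportAtTwo`), crux K4 `SignedControlAtTwo`
(stmt-BirchSwinnertonDyer-20309), line `eulerchar`, stub 3 `stub_poitouTateThreeRealRat`.  Seat `prover-bsd-wall-tp2-p3` (lead, gen 5).
Brick B7 of the lead's dévissage: after B1–B5 (`…ShaThreeExtension/PGroup/OddDescent/Assembly/SylowField`) the named fact
`poitouTate_three_realPlaces_injective K` holds for every number field as soon as (hbase) the real-place injectivity of `H³`
holds at the TRIVIAL module of order `2` over every number field `F` (+ Cor. 4.16).  This file reduces (hbase) to class field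
theory of the multiplicative group `𝔾_m = F̄ˣ` (tree module `units F`), through the Kummer sequence
`0 → μ₂ → F̄ˣ →² F̄ˣ → 0` (tree `isSES_kummer F 2`) in degrees `2 → 3`:

* §1 `realThree_injective_mu_two_of_brauer` — for a number field `F`: IF (hH3) `H³(F, F̄ˣ)` has no `2`-torsion (in print:
  `H³(F, 𝔾_m) = 0`, Tate) and (hBr) every `u ∈ H²(F, F̄ˣ) = Br(F)` whose localisation at every real place `w` is of the form
  `u'_w + u'_w` in `H²(F_w, F̄ˣ)` (i.e. vanishes in `Br(F_w) ≅ ℤ/2`) is itself of the form `u'' + u''` (in print: `Br(F)/2 ≅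
  ⊕_{w real} Br(F_w)`, both halves of Brauer–Hasse–Noether), THEN every class of `H³(F, μ₂)` vanishing at all real places is
  `0`.  Cochain proof: `x = [a]`, `ι_*x` is `2`-torsion hence `0`, so `ι ∘ a = dγ` and `u := [2γ] ∈ H²(F, F̄ˣ)`
  (`x = δ₂ u`); at a real `w`, `a|_w = dκ_w` makes `γ|_w - ι κ_w` a local `2`-cocycle with `2 · [γ|_w - ικ_w] = u|_w`; by (hBr)
  `u = [φ] + [φ]`, so `2γ - 2φ - dθ = 0`-ish: `γ - φ - dθ̃ = ι ∘ b` and `a = db`.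
* §2 `realThree_injective_orderTwo_of_brauer` — the same for EVERY discrete `Γ_F`-module `T` of order `2` with trivial action
  (transport along `T ≅ μ₂(F̄)`; `Γ_F` acts trivially on `μ₂`, tree `WeierstrassCurve.mu_two_apply_eq`) = hypothesis (hbase) of
  `poitouTate_three_realPlaces_injective_of_base` AT `F`.
* §3 `poitouTate_three_realPlaces_injective_of_brauer` — **`poitouTate_three_realPlaces_injective K` for every number field `K`
  from (hH3), (hBr) over every number field and Cor. 4.16 over every number field.**

HONEST FRAMING: THEOREMS ONLY (no definition, no named fact, no `sorry`); CONDITIONAL on the displayed hypotheses (hH3), (hBr) —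
class-field-theoretic statements about `𝔾_m` (`H³(F,𝔾_m)[2] = 0`; `Br(F)/2` is detected at the real places), NOT proved here — and
(h416); closes no item by itself; BSD is not proved by any of this.

References: [MilneADT2006] I Thm. 4.10 (c); [CasselsFrohlichANT1967] Ch. VII §9.6, §11 (Tate: `H³(G_F, C) = 0`,
Brauer–Hasse–Noether); [SerreGaloisCohomology1997] II §1.2 (Kummer theory).
-/

set_option autoImplicit false
-- the Theorems namespace of this sub repeats the summit name by design (D-0017 nested layout)
set_option linter.dupNamespace false

noncomputable section

open CategoryTheory NumberField Field Function
open _root_.TopRep _root_.ContRepresentation _root_.ContinuousCohomology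
open Literature.NumberTheory.GaloisRepresentations
open Literature.NumberTheory.GaloisRepresentations.DiscreteGaloisModule (mu MuCarrier units UnitsCarrier)
open Literature.NumberTheory.GaloisCohomology

namespace Summit.BirchSwinnertonDyer.BirchSwinnertonDyer.Theorems.SignedEC.ShaThree

variable (F : Type) [Field F] [NumberField F]

/-! ## §1 `μ₂`: real-place injectivity of `H³(F, μ₂)` from the Brauer group -/

section MuTwo

/-- **Real-place injectivity of `H³(F, μ₂)` from `H³(F, 𝔾_m)[2] = 0` and the real-place detection of `Br(F)/2`.**
(hH3): `z + z = 0 → z = 0` on `H³(F, F̄ˣ)`; (hBr): a class of `H²(F, F̄ˣ)` which is twice a class locally at every real place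
is twice a class.  Conclusion: a class of `H³(F, μ₂)` vanishing at all real places is `0`.
[cite: MilneADT2006, Ch. I, Thm. 4.10 (c)] [cite: CasselsFrohlichANT1967, Ch. VII §11] [cite: SerreGaloisCohomology1997, II §1.2] -/
theorem realThree_injective_mu_two_of_brauer
    (hH3 : ∀ z : galoisCohomology (units F) 3, z + z = 0 → z = 0)
    (hBr : ∀ u : galoisCohomology (units F) 2,
      (∀ w : InfinitePlace F, w.IsReal → ∃ u' : galoisCohomology ((units F).toLocal (Sum.inl w)) 2,
        galoisCohomology.localization (units F) (Sum.inl w) 2 u = u' + u') →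
      ∃ u'' : galoisCohomology (units F) 2, u = u'' + u'') :
    ∀ c : galoisCohomology (mu F 2) 3,
      (∀ w : InfinitePlace F, w.IsReal → galoisCohomology.localization (mu F 2) (Sum.inl w) 3 c = 0) → c = 0 := by
  classical
  intro c hc
  haveI : CompactSpace (absoluteGaloisGroup F) := absoluteGaloisGroup_compactSpace F
  haveI : ∀ w : InfinitePlace F, CompactSpace (absoluteGaloisGroup (Place.Completion (Sum.inl w : Place F))) :=
    fun w => absoluteGaloisGroup_compactSpace _
  -- localisation on explicit cocycles (degrees 2 and 3)
  have loc₂ : ∀ {N : Type} [AddCommGroup N] [TopologicalSpace N] [DiscreteTopology N]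
      (τ : DiscreteGaloisModule F N) (w : InfinitePlace F) (d : contTwoCocycles τ.toTopRep),
      galoisCohomology.localization τ (Sum.inl w) 2 (twoCocycleClass τ.toTopRep d) =
        twoCocycleClass (DiscreteGaloisModule.toTopRep (τ.toLocal (Sum.inl w)))
          (contTwoCocycles.pullback (absGaloisRestrict F (Place.Completion (Sum.inl w : Place F)))
            (X := τ.toTopRep) (Y := DiscreteGaloisModule.toTopRep (τ.toLocal (Sum.inl w)))
            (TopRep.ofHom ⟨ContinuousLinearMap.id ℤ N, fun _ => rfl⟩) d) :=
    fun τ w d ↦ map_twoCocycleClass _ _ _ d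
  have loc₃ : ∀ {N : Type} [AddCommGroup N] [TopologicalSpace N] [DiscreteTopology N]
      (τ : DiscreteGaloisModule F N) (w : InfinitePlace F) (d : contThreeCocycles τ.toTopRep),
      galoisCohomology.localization τ (Sum.inl w) 3 (threeCocycleClass τ.toTopRep d) =
        threeCocycleClass (DiscreteGaloisModule.toTopRep (τ.toLocal (Sum.inl w)))
          (contThreeCocycles.pullback (absGaloisRestrict F (Place.Completion (Sum.inl w : Place F)))
            (X := τ.toTopRep) (Y := DiscreteGaloisModule.toTopRep (τ.toLocal (Sum.inl w)))
            (TopRep.ofHom ⟨ContinuousLinearMap.id ℤ N, fun _ => rfl⟩) d) :=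
    fun τ w d ↦ map_threeCocycleClass _ _ _ d
  set Γ := absoluteGaloisGroup F with hΓ
  let Γl : InfinitePlace F → Type := fun w => absoluteGaloisGroup (Place.Completion (Sum.inl w : Place F))
  let r : ∀ w : InfinitePlace F, Γl w →ₜ* Γ := fun w => absGaloisRestrict F (Place.Completion (Sum.inl w : Place F))
  -- the Kummer sequence `0 → μ₂ →ι F̄ˣ →π F̄ˣ → 0`
  set ι := kummerι F 2 with hι
  set π := kummerπ F 2 with hπ
  have h : IsSES ι π := isSES_kummer F 2 two_pos
  have hπx : ∀ x : UnitsCarrier F, π.hom x = x + x := fun x => by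
    rw [hπ, kummerπ_hom_apply, Nat.cast_ofNat, two_zsmul]
  let ιC : C(MuCarrier F 2, UnitsCarrier F) := ⟨ι.hom, ι.hom.continuous⟩
  let πC : C(UnitsCarrier F, UnitsCarrier F) := ⟨π.hom, π.hom.continuous⟩
  have hπd : ∀ (b : C(Γ × Γ, UnitsCarrier F)) (σ τ υ : Γ), π.hom (dTwo (units F).toTopRep b σ τ υ) =
      dTwo (units F).toTopRep (πC.comp b) σ τ υ := fun b σ τ υ => by
    rw [dTwo_apply, dTwo_apply, map_sub, map_add, map_sub, TopRep.hom_comm_apply π σ]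
    rfl
  have hιd : ∀ (b : C(Γ × Γ, MuCarrier F 2)) (σ τ υ : Γ), ι.hom (dTwo (mu F 2).toTopRep b σ τ υ) =
      dTwo (units F).toTopRep (ιC.comp b) σ τ υ := fun b σ τ υ => by
    rw [dTwo_apply, dTwo_apply, map_sub, map_add, map_sub, TopRep.hom_comm_apply ι σ]
    rfl
  obtain ⟨a, rfl⟩ := threeCocycleClass_surjective _ c
  -- every element of `μ₂` is killed by `2`
  have haa : ∀ p, a.1 p + a.1 p = 0 := fun p => by
    have h2 := zsmul_muCarrier_eq_zero F 2 (a.1 p)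
    rw [Nat.cast_ofNat, two_zsmul] at h2
    exact h2
  /- Step 1: `ι_* [a]` is `2`-torsion, hence `0` by (hH3): `ι ∘ a = dγ`. -/
  let ιa : contThreeCocycles (units F).toTopRep :=
    contThreeCocycles.pullback (ContinuousMonoidHom.id Γ) (resIdHom ι) a
  have hιa : ∀ σ τ υ, ιa.1 (σ, τ, υ) = ι.hom (a.1 (σ, τ, υ)) := fun _ _ _ => rfl
  have hιa0 : threeCocycleClass (units F).toTopRep ιa = 0 := by
    refine hH3 _ ?_
    have hsum : ιa + ιa = 0 := Subtype.ext (ContinuousMap.ext fun ⟨σ, τ, υ⟩ => by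
      change ιa.1 (σ, τ, υ) + ιa.1 (σ, τ, υ) = 0
      rw [hιa, ← map_add, haa, map_zero])
    have h0 : threeCocycleClass (units F).toTopRep (ιa + ιa) = 0 := by rw [hsum, threeCocycleClass_zero]
    rw [threeCocycleClass_add] at h0
    exact h0
  obtain ⟨γ, hγ⟩ : ∃ γ : C(Γ × Γ, UnitsCarrier F), ∀ σ τ υ, ιa.1 (σ, τ, υ) = dTwo (units F).toTopRep γ σ τ υ :=
    (threeCocycleClass_eq_zero_iff_dTwo _ _).1 hιa0
  have hγ' : ∀ σ τ υ, dTwo (units F).toTopRep γ σ τ υ = ι.hom (a.1 (σ, τ, υ)) := fun σ τ υ => by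
    rw [← hιa, hγ]
  -- `ψ := π ∘ γ = 2γ` is a `2`-cocycle; `u := [ψ]`
  have hψ : πC.comp γ ∈ contTwoCocycles (units F).toTopRep :=
    (mem_contTwoCocycles_iff_dTwo _ _).2 fun σ τ υ => by
      rw [← hπd, hγ']
      exact h.g_f_apply _
  let ψ : contTwoCocycles (units F).toTopRep := ⟨_, hψ⟩
  have hψapply : ∀ σ τ, ψ.1 (σ, τ) = π.hom (γ (σ, τ)) := fun _ _ => rfl
  /- Step 2: at a real place `w`, `u|_w` is twice a class. -/
  have hloc : ∀ w : InfinitePlace F, w.IsReal →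
      ∃ u' : galoisCohomology ((units F).toLocal (Sum.inl w)) 2,
        galoisCohomology.localization (units F) (Sum.inl w) 2 (twoCocycleClass _ ψ) = u' + u' := by
    intro w hw
    have hcw := hc w hw
    rw [loc₃] at hcw
    obtain ⟨κ, hκ⟩ : ∃ κ : C(Γl w × Γl w, MuCarrier F 2), ∀ σ τ υ,
        (contThreeCocycles.pullback (r w) (X := (mu F 2).toTopRep)
          (Y := DiscreteGaloisModule.toTopRep ((mu F 2).toLocal (Sum.inl w)))
          (TopRep.ofHom ⟨ContinuousLinearMap.id ℤ (MuCarrier F 2), fun _ => rfl⟩) a).1 (σ, τ, υ) =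
        dTwo (DiscreteGaloisModule.toTopRep ((mu F 2).toLocal (Sum.inl w))) κ σ τ υ :=
      (threeCocycleClass_eq_zero_iff_dTwo _ _).1 hcw
    have hκ' : ∀ σ τ υ, a.1 (r w σ, r w τ, r w υ) =
        dTwo (DiscreteGaloisModule.toTopRep ((mu F 2).toLocal (Sum.inl w))) κ σ τ υ := fun σ τ υ => hκ σ τ υ
    -- the local `2`-cocycle `γ|_w - ι ∘ κ`
    let γw : C(Γl w × Γl w, UnitsCarrier F) := γ.comp ((r w : C(Γl w, Γ)).prodMap (r w : C(Γl w, Γ)))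
    let φw : C(Γl w × Γl w, UnitsCarrier F) := γw - ιC.comp κ
    have hφw_apply : ∀ σ τ, φw (σ, τ) = γ (r w σ, r w τ) - ι.hom (κ (σ, τ)) := fun _ _ => rfl
    have hιdl : ∀ σ τ υ, ι.hom (dTwo (DiscreteGaloisModule.toTopRep ((mu F 2).toLocal (Sum.inl w))) κ σ τ υ) =
        dTwo (DiscreteGaloisModule.toTopRep ((units F).toLocal (Sum.inl w))) (ιC.comp κ) σ τ υ := fun σ τ υ => by
      rw [dTwo_apply, dTwo_apply, map_sub, map_add, map_sub]
      change ι.hom ((mu F 2) (r w σ) (κ (τ, υ))) - _ + _ - _ = (units F) (r w σ) (ι.hom (κ (τ, υ))) - _ + _ - _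
      rw [ContinuousRep.hom_comm_apply ι (r w σ)]
      rfl
    have hγl : ∀ σ τ υ, dTwo (DiscreteGaloisModule.toTopRep ((units F).toLocal (Sum.inl w))) γw σ τ υ =
          dTwo (units F).toTopRep γ (r w σ) (r w τ) (r w υ) := fun σ τ υ => by
      rw [dTwo_apply, dTwo_apply]
      change (units F) (r w σ) (γ (r w τ, r w υ)) - γ (r w (σ * τ), r w υ) + γ (r w σ, r w (τ * υ)) -
        γ (r w σ, r w τ) = _
      rw [map_mul, map_mul]
      rfl
    have hφw : φw ∈ contTwoCocycles (DiscreteGaloisModule.toTopRep ((units F).toLocal (Sum.inl w))) :=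
      (mem_contTwoCocycles_iff_dTwo _ _).2 fun σ τ υ => by
        change dTwo (DiscreteGaloisModule.toTopRep ((units F).toLocal (Sum.inl w))) (γw - ιC.comp κ) σ τ υ = 0
        rw [dTwo_sub, hγl, hγ', ← hιdl, ← hκ', sub_self]
    refine ⟨twoCocycleClass _ ⟨φw, hφw⟩, ?_⟩
    have h1 : galoisCohomology.localization (units F) (Sum.inl w) 2 (twoCocycleClass _ ψ) =
        twoCocycleClass (DiscreteGaloisModule.toTopRep ((units F).toLocal (Sum.inl w)))
          (⟨φw, hφw⟩ + ⟨φw, hφw⟩) := by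
      rw [loc₂]
      refine congrArg _ (Subtype.ext (ContinuousMap.ext fun ⟨σ, τ⟩ => ?_))
      change ψ.1 (r w σ, r w τ) = φw (σ, τ) + φw (σ, τ)
      rw [hψapply, hφw_apply, ← hπx, map_sub, h.g_f_apply, sub_zero]
    rw [twoCocycleClass_add] at h1
    exact h1
  /- Step 3: (hBr) gives `u = [φ] + [φ]`; then `γ - φ - dθ̃ = ι ∘ b` and `a = db`. -/
  obtain ⟨u'', hu''⟩ := hBr (twoCocycleClass _ ψ) hloc
  obtain ⟨φ, rfl⟩ := twoCocycleClass_surjective _ u''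
  have hu3 : (twoCocycleClass (units F).toTopRep ψ : continuousCohomology 2 (units F).toTopRep) =
      twoCocycleClass (units F).toTopRep φ + twoCocycleClass (units F).toTopRep φ := hu''
  have hdiff : twoCocycleClass (units F).toTopRep (ψ - (φ + φ)) = 0 := by
    rw [twoCocycleClass_sub, twoCocycleClass_add, hu3, sub_self]
  obtain ⟨θ, hθ⟩ := (twoCocycleClass_eq_zero_iff _ _).1 hdiff
  have hθ' : ∀ σ τ, π.hom (γ (σ, τ)) - (φ.1 (σ, τ) + φ.1 (σ, τ)) =
      (units F) σ (θ τ) - θ (σ * τ) + θ σ := fun σ τ => hθ σ τ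
  let θt : C(Γ, UnitsCarrier F) := ⟨h.lift ∘ θ, (continuous_of_discreteTopology (f := h.lift)).comp θ.continuous⟩
  have hθt : ∀ σ, π.hom (θt σ) = θ σ := fun σ => h.g_lift _
  let γ' : C(Γ × Γ, UnitsCarrier F) := γ - φ.1 - ((units F).twoCoboundary θt : contTwoCocycles _).1
  have hγ'apply : ∀ σ τ, γ' (σ, τ) = γ (σ, τ) - φ.1 (σ, τ) - ((units F) σ (θt τ) - θt (σ * τ) + θt σ) :=
    fun _ _ => rfl
  have hγ'π : ∀ p, π.hom (γ' p) = 0 := fun ⟨σ, τ⟩ => by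
    rw [hγ'apply, map_sub, map_sub, map_add, map_sub, ContinuousRep.hom_comm_apply π σ, hθt, hθt, hθt, ← hθ',
      hπx (φ.1 _)]
    abel
  let b : C(Γ × Γ, MuCarrier F 2) := ⟨h.inv ∘ γ', (continuous_of_discreteTopology (f := h.inv)).comp γ'.continuous⟩
  have hιb : ∀ p, ι.hom (b p) = γ' p := fun p => h.f_inv (hγ'π p)
  have hab : ∀ σ τ υ, a.1 (σ, τ, υ) = dTwo (mu F 2).toTopRep b σ τ υ := fun σ τ υ => by
    apply h.injective
    rw [← hγ', hιd]
    have hιbC : ιC.comp b = γ' := ContinuousMap.ext fun p => hιb p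
    rw [hιbC]
    change dTwo (units F).toTopRep γ σ τ υ =
      dTwo (units F).toTopRep (γ - φ.1 - ((units F).twoCoboundary θt : contTwoCocycles _).1) σ τ υ
    rw [dTwo_sub, dTwo_sub, dTwo_coe_contTwoCocycles, dTwo_coe_contTwoCocycles, sub_zero, sub_zero]
  exact (threeCocycleClass_eq_zero_iff_dTwo _ _).2 ⟨b, hab⟩

end MuTwo

/-! ## §2 Every trivial module of order `2` -/

section OrderTwo

/-- **The (hbase) input of `poitouTate_three_realPlaces_injective_of_base` AT `F`, from the Brauer-group statements**:
for every discrete `Γ_F`-module `T` of order `2` with trivial action, a class of `H³(F, T)` vanishing at all real places is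
`0` — transport of §1 along the (equivariant, both actions being trivial) isomorphism `T ≅ μ₂(F̄)`.
[cite: MilneADT2006, Ch. I, Thm. 4.10 (c)] [cite: CasselsFrohlichANT1967, Ch. VII §11] -/
theorem realThree_injective_orderTwo_of_brauer
    (hH3 : ∀ z : galoisCohomology (units F) 3, z + z = 0 → z = 0)
    (hBr : ∀ u : galoisCohomology (units F) 2,
      (∀ w : InfinitePlace F, w.IsReal → ∃ u' : galoisCohomology ((units F).toLocal (Sum.inl w)) 2,
        galoisCohomology.localization (units F) (Sum.inl w) 2 u = u' + u') →
      ∃ u'' : galoisCohomology (units F) 2, u = u'' + u'')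
    (T : Type) [AddCommGroup T] [TopologicalSpace T] [DiscreteTopology T] [Finite T]
    (σT : DiscreteGaloisModule F T) (htriv : ∀ (g : absoluteGaloisGroup F) (t : T), σT g t = t)
    (hcard : Nat.card T = 2) :
    ∀ c : galoisCohomology σT 3,
      (∀ w : InfinitePlace F, w.IsReal → galoisCohomology.localization σT (Sum.inl w) 3 c = 0) → c = 0 := by
  classical
  intro c hc
  haveI : CompactSpace (absoluteGaloisGroup F) := absoluteGaloisGroup_compactSpace F
  haveI : ∀ w : InfinitePlace F, CompactSpace (absoluteGaloisGroup (Place.Completion (Sum.inl w : Place F))) :=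
    fun w => absoluteGaloisGroup_compactSpace _
  have loc₃ : ∀ {N : Type} [AddCommGroup N] [TopologicalSpace N] [DiscreteTopology N]
      (τ : DiscreteGaloisModule F N) (w : InfinitePlace F) (d : contThreeCocycles τ.toTopRep),
      galoisCohomology.localization τ (Sum.inl w) 3 (threeCocycleClass τ.toTopRep d) =
        threeCocycleClass (DiscreteGaloisModule.toTopRep (τ.toLocal (Sum.inl w)))
          (contThreeCocycles.pullback (absGaloisRestrict F (Place.Completion (Sum.inl w : Place F)))
            (X := τ.toTopRep) (Y := DiscreteGaloisModule.toTopRep (τ.toLocal (Sum.inl w)))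
            (TopRep.ofHom ⟨ContinuousLinearMap.id ℤ N, fun _ => rfl⟩) d) :=
    fun τ w d ↦ map_threeCocycleClass _ _ _ d
  set Γ := absoluteGaloisGroup F with hΓ
  let Γl : InfinitePlace F → Type := fun w => absoluteGaloisGroup (Place.Completion (Sum.inl w : Place F))
  let r : ∀ w : InfinitePlace F, Γl w →ₜ* Γ := fun w => absGaloisRestrict F (Place.Completion (Sum.inl w : Place F))
  -- the additive isomorphism `T ≃ μ₂(F̄)` (both cyclic of order `2`), equivariant since both actions are trivial
  have hcycT : IsAddCyclic T := isAddCyclic_of_prime_card hcard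
  let e : T ≃+ MuCarrier F 2 :=
    (zmodAddCyclicAddEquiv hcycT).symm.trans
      ((ZMod.ringEquivCongr hcard).toAddEquiv.trans (muCarrierZModEquiv F 2).symm)
  have hmu : ∀ (g : Γ) (v : MuCarrier F 2), mu F 2 g v = v := WeierstrassCurve.mu_two_apply_eq
  obtain ⟨z, rfl⟩ := threeCocycleClass_surjective _ c
  -- `e ∘ z`, a `3`-cocycle of `μ₂`
  let eC : C(T, MuCarrier F 2) := ⟨e, continuous_of_discreteTopology⟩
  let ez : contThreeCocycles (mu F 2).toTopRep :=
    ⟨eC.comp z.1, fun σ τ υ ω => by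
      have key := z.2 σ τ υ ω
      change σT σ (z.1 (τ, υ, ω)) + z.1 (σ, τ * υ, ω) + z.1 (σ, τ, υ) = z.1 (σ * τ, υ, ω) + z.1 (σ, τ, υ * ω) at key
      change mu F 2 σ (e (z.1 (τ, υ, ω))) + e (z.1 (σ, τ * υ, ω)) + e (z.1 (σ, τ, υ)) =
        e (z.1 (σ * τ, υ, ω)) + e (z.1 (σ, τ, υ * ω))
      rw [hmu, htriv] at *
      rw [← map_add, ← map_add, key, map_add]⟩
  -- it vanishes at the real places
  have hez : ∀ w : InfinitePlace F, w.IsReal →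
      galoisCohomology.localization (mu F 2) (Sum.inl w) 3 (threeCocycleClass _ ez) = 0 := by
    intro w hw
    have hcw := hc w hw
    rw [loc₃] at hcw ⊢
    obtain ⟨κ, hκ⟩ := (threeCocycleClass_eq_zero_iff_dTwo _ _).1 hcw
    refine (threeCocycleClass_eq_zero_iff_dTwo _ _).2 ⟨eC.comp κ, fun σ τ υ => ?_⟩
    have hκ' : z.1 (r w σ, r w τ, r w υ) = dTwo (DiscreteGaloisModule.toTopRep (σT.toLocal (Sum.inl w))) κ σ τ υ :=
      hκ σ τ υ
    change e (z.1 (r w σ, r w τ, r w υ)) = _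
    rw [hκ', dTwo_apply, dTwo_apply]
    change e (σT (r w σ) (κ (τ, υ)) - κ (σ * τ, υ) + κ (σ, τ * υ) - κ (σ, τ)) =
      mu F 2 (r w σ) (e (κ (τ, υ))) - e (κ (σ * τ, υ)) + e (κ (σ, τ * υ)) - e (κ (σ, τ))
    rw [htriv, hmu, map_sub, map_add, map_sub]
  -- §1: `[e ∘ z] = 0`, i.e. `e ∘ z = db`; then `z = d(e⁻¹ ∘ b)`
  have hez0 := realThree_injective_mu_two_of_brauer F hH3 hBr (threeCocycleClass _ ez) hez
  obtain ⟨b, hb⟩ := (threeCocycleClass_eq_zero_iff_dTwo _ _).1 hez0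
  let eC' : C(MuCarrier F 2, T) := ⟨e.symm, continuous_of_discreteTopology⟩
  refine (threeCocycleClass_eq_zero_iff_dTwo _ _).2 ⟨eC'.comp b, fun σ τ υ => ?_⟩
  have hb' : e (z.1 (σ, τ, υ)) = dTwo (mu F 2).toTopRep b σ τ υ := hb σ τ υ
  apply e.injective
  rw [hb', dTwo_apply, dTwo_apply]
  change mu F 2 σ (b (τ, υ)) - b (σ * τ, υ) + b (σ, τ * υ) - b (σ, τ) =
    e (σT σ (e.symm (b (τ, υ))) - e.symm (b (σ * τ, υ)) + e.symm (b (σ, τ * υ)) - e.symm (b (σ, τ)))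
  rw [hmu, htriv, map_sub, map_add, map_sub, e.apply_symm_apply, e.apply_symm_apply, e.apply_symm_apply,
    e.apply_symm_apply]

end OrderTwo

/-! ## §3 The named fact from the Brauer-group statements -/

section Final

/-- **Milne I Thm. 4.10 (c), `r = 3`, injectivity — `poitouTate_three_realPlaces_injective K` for every number field `K` — from
class field theory of `𝔾_m` and Cor. 4.16**: (hH3) `H³(F, F̄ˣ)` has no `2`-torsion, for every number field `F`; (hBr) a class of
`H²(F, F̄ˣ) = Br(F)` which is twice a class at every real place is twice a class, for every `F`; (h416) Milne I Cor. 4.16 for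
every `F`.  (`= poitouTate_three_realPlaces_injective_of_base` + `realThree_injective_orderTwo_of_brauer`.)
[cite: MilneADT2006, Ch. I, Thm. 4.10 (c) and Cor. 4.16] [cite: CasselsFrohlichANT1967, Ch. VII §11] -/
theorem poitouTate_three_realPlaces_injective_of_brauer (K : Type) [Field K] [NumberField K]
    (hH3 : ∀ (F : Type) [Field F] [NumberField F] (z : galoisCohomology (units F) 3), z + z = 0 → z = 0)
    (hBr : ∀ (F : Type) [Field F] [NumberField F] (u : galoisCohomology (units F) 2),
      (∀ w : InfinitePlace F, w.IsReal → ∃ u' : galoisCohomology ((units F).toLocal (Sum.inl w)) 2,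
        galoisCohomology.localization (units F) (Sum.inl w) 2 u = u' + u') →
      ∃ u'' : galoisCohomology (units F) 2, u = u'' + u'')
    (h416 : ∀ (F : Type) [Field F] [NumberField F], poitouTate_two_realPlaces_surjective F) :
    poitouTate_three_realPlaces_injective K :=
  poitouTate_three_realPlaces_injective_of_base K
    (fun F _ _ T _ _ _ _ σ htriv hcard => realThree_injective_orderTwo_of_brauer F (hH3 F) (hBr F) T σ htriv hcard) h416

end Final

end Summit.BirchSwinnertonDyer.BirchSwinnertonDyer.Theorems.SignedEC.ShaThree

end
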